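import Literature.MathematicalPhysics.QuantumLattice.GibbsBogoliubovRow
import Literature.MathematicalPhysics.QuantumLattice.TorusGibbsEnergyEntropyBalance
import HarnessLib

/-!
# The Bogoliubov row for the TRANSLATED canonical Gibbs eigen-mixtures of the `t–t'` Hubbard torus

Topic `Literature/MathematicalPhysics/QuantumLattice`; the Bogoliubov-row twin of
`TorusGibbsEnergyEntropyBalance.lean` (which does the same for the linearised energy–entropy-balance
rows). The finite-volume Bogoliubov row (`GibbsBogoliubovRow.lean`, from Dyson–Lieb–Simon's general
operator Bogoliubov inequality [DLS1978] (28)) reads, for the canonical eigen-mixture `(w_a, ψ_a)` of a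
Hermitian `A` in an invariant coordinate sector and sector-preserving `B`, `C`:

  `0 ≤ Σ_a w_a Re⟨ψ_a, G_β(A; B, C) ψ_a⟩`,
  `G_β(A; B, C) = BBᴴ + BᴴB + 2·(CB − BC) + (β/2)·(Cᴴ(AC − CA) − (AC − CA)Cᴴ)`.

Torus-limit states are limits of TRANSLATION-AVERAGED torus expectations, so the inequality is needed
for the translated mixtures `(p_{L,i}, U_v ψ_{L,i})` of the canonical Gibbs data
`sectorGibbsWeightTT'`, `sectorGibbsVectorTT'` of `H_L = hubbardTorusTT' L t t' U` on the sector
`(rectN n L, S^z = 0)`: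

* §1 (generic matrices) **unitary covariance** `Uᴴ G_β(A; B, C) U = G_β(A; UᴴBU, UᴴCU)` for `U`
  unitary commuting with `A` (`conjTranspose_mul_bog_mul_of_commute`,
  `star_mulVec_dotProduct_bog_mulVec_mulVec`), hence the sector inequality for `(w_a, Uψ_a)` when
  `U`, `Uᴴ` preserve the sector (`sum_canonicalWeight_mul_re_expect_bog_mulVec_nonneg`);
* §2 (the torus) **`0 ≤ Σ_i p_{L,i} Re⟨U_vψ_{L,i}, G_β(H_L; B, C) U_vψ_{L,i}⟩`** for all torus
  operators `B`, `C` commuting with `N` and `S^z`, every translation `v` and every `β ≥ 0`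
  (`sum_sectorGibbsWeightTT'_mul_re_expect_bog_fockTranslate_nonneg`). No hypothesis on `t, t', U, n`.

Everything is PROVED; no definition, no named fact, no instance.

## Mathlib / tree search

REUSED: `sum_canonicalWeight_mul_re_expect_bog_nonneg` (`GibbsBogoliubovRow`); `mul_apply_eq_zero_off`
(`GibbsEnergyEntropyBalance`); `fockTranslate_val_conjTranspose_mul_val_mul`,
`fockTranslate_val_mul_val_conjTranspose_mul`, `apply_eq_zero_of_szConfig_of_commute`,
`conjTranspose_apply_eq_zero_of_szConfig_of_commute`, `fockTranslate_apply_eq_zero_of_szConfig`,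
`fockTranslate_val_conjTranspose_eq_neg` (`TorusGibbsEnergyEntropyBalance`); `sectorGibbs*TT'`,
`hubbardTorusTT'_apply_eq_zero_of_szConfig`, `sectorGibbsIndex` (`TorusSectorGibbsMixture`);
`fockTranslate_commute_hubbardTorusTT'`; `star_mulVec_dotProduct_mulVec_mulVec` (`CompressedFormOnSector`).

## References

* [DLS1978] F. J. Dyson, E. H. Lieb, B. Simon, J. Stat. Phys. 18 (1978) 335–383, §2 eq. (28).
  [cite: DLS1978, §2 eq. (28)]
* O. Bratteli, D. W. Robinson, *Operator Algebras and Quantum Statistical Mechanics 2* (1997),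
  §5.2.2 Thm. 5.2.5 (unitarily implemented one-particle symmetries).
  [cite: BratteliRobinsonII1997, §5.2.2 Thm. 5.2.5]
* E. H. Lieb, Phys. Rev. Lett. 62 (1989) 1201, Remark (2) (`H` conserves `N↑`, `N↓`; sectors).
  [cite: LiebPRL1989, Remark (2)]
-/

noncomputable section

namespace Literature.MathematicalPhysics.QuantumLattice

open Matrix Finset HubbardWave0 Literature.Probability.LatticeModels ThermodynamicLimit
open _root_.Filter
open scoped _root_.Topology ComplexOrder BigOperators

/-! ### §1 Covariance: the Bogoliubov row observable in unitarily transformed eigen-mixtures -/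

section Covariance

variable {ι : Type*} [Fintype ι] [DecidableEq ι]

omit [DecidableEq ι] in
/-- **Unitary covariance of the Bogoliubov row observable**: for `U` unitary commuting with `A`,
`Uᴴ G_β(A; B, C) U = G_β(A; UᴴBU, UᴴCU)`. [cite: DLS1978, §2 eq. (28)] -/
theorem conjTranspose_mul_bog_mul_of_commute {U A : Matrix ι ι ℂ} (hU : ∀ X : Matrix ι ι ℂ, Uᴴ * (U * X) = X)
    (hU' : ∀ X : Matrix ι ι ℂ, U * (Uᴴ * X) = X) (hUA : Commute U A) (B C : Matrix ι ι ℂ) (β : ℝ) :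
    Uᴴ * (B * Bᴴ + Bᴴ * B + ((2 : ℝ) : ℂ) • (C * B - B * C) +
        ((β / 2 : ℝ) : ℂ) • (Cᴴ * (A * C - C * A) - (A * C - C * A) * Cᴴ)) * U =
      (Uᴴ * B * U) * (Uᴴ * B * U)ᴴ + (Uᴴ * B * U)ᴴ * (Uᴴ * B * U) +
        ((2 : ℝ) : ℂ) • ((Uᴴ * C * U) * (Uᴴ * B * U) - (Uᴴ * B * U) * (Uᴴ * C * U)) +
        ((β / 2 : ℝ) : ℂ) • ((Uᴴ * C * U)ᴴ * (A * (Uᴴ * C * U) - (Uᴴ * C * U) * A) -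
          (A * (Uᴴ * C * U) - (Uᴴ * C * U) * A) * (Uᴴ * C * U)ᴴ) := by
  have hconj : ∀ Y Z : Matrix ι ι ℂ, Uᴴ * (Y * Z) * U = (Uᴴ * Y * U) * (Uᴴ * Z * U) := by
    intro Y Z
    calc Uᴴ * (Y * Z) * U = Uᴴ * Y * (Z * U) := by simp only [Matrix.mul_assoc]
      _ = Uᴴ * Y * (U * (Uᴴ * (Z * U))) := by rw [hU']
      _ = (Uᴴ * Y * U) * (Uᴴ * Z * U) := by simp only [Matrix.mul_assoc]
  have hA : Uᴴ * A * U = A := by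
    rw [Matrix.mul_assoc, ← hUA.eq, hU]
  have hBt : (Uᴴ * B * U)ᴴ = Uᴴ * Bᴴ * U := by
    rw [conjTranspose_mul, conjTranspose_mul, conjTranspose_conjTranspose, Matrix.mul_assoc]
  have hCt : (Uᴴ * C * U)ᴴ = Uᴴ * Cᴴ * U := by
    rw [conjTranspose_mul, conjTranspose_mul, conjTranspose_conjTranspose, Matrix.mul_assoc]
  rw [hBt, hCt]
  simp only [Matrix.mul_add, Matrix.mul_sub, Matrix.add_mul, Matrix.sub_mul, Matrix.mul_smul,
    Matrix.smul_mul, hconj, hA]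

omit [DecidableEq ι] in
/-- The Bogoliubov-row expectation in a transformed vector is the expectation, in the original vector,
of the row built from the transformed observables `UᴴBU`, `UᴴCU` (`U` unitary commuting with `A`).
[cite: DLS1978, §2 eq. (28)] -/
theorem star_mulVec_dotProduct_bog_mulVec_mulVec {U A : Matrix ι ι ℂ} (hU : ∀ X : Matrix ι ι ℂ, Uᴴ * (U * X) = X)
    (hU' : ∀ X : Matrix ι ι ℂ, U * (Uᴴ * X) = X) (hUA : Commute U A) (B C : Matrix ι ι ℂ) (β : ℝ)
    (ψ : ι → ℂ) :
    star (U *ᵥ ψ) ⬝ᵥ ((B * Bᴴ + Bᴴ * B + ((2 : ℝ) : ℂ) • (C * B - B * C) +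
        ((β / 2 : ℝ) : ℂ) • (Cᴴ * (A * C - C * A) - (A * C - C * A) * Cᴴ)) *ᵥ (U *ᵥ ψ)) =
      star ψ ⬝ᵥ (((Uᴴ * B * U) * (Uᴴ * B * U)ᴴ + (Uᴴ * B * U)ᴴ * (Uᴴ * B * U) +
        ((2 : ℝ) : ℂ) • ((Uᴴ * C * U) * (Uᴴ * B * U) - (Uᴴ * B * U) * (Uᴴ * C * U)) +
        ((β / 2 : ℝ) : ℂ) • ((Uᴴ * C * U)ᴴ * (A * (Uᴴ * C * U) - (Uᴴ * C * U) * A) -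
          (A * (Uᴴ * C * U) - (Uᴴ * C * U) * A) * (Uᴴ * C * U)ᴴ)) *ᵥ ψ) := by
  rw [star_mulVec_dotProduct_mulVec_mulVec U _ ψ ψ, conjTranspose_mul_bog_mul_of_commute hU hU' hUA]

variable (p : ι → Prop) [DecidablePred p]

/-- **Bogoliubov row for unitarily transformed canonical sector eigen-mixtures.** Under the hypotheses
of `sum_canonicalWeight_mul_re_expect_bog_nonneg`, if moreover `U` is unitary, commutes with `A`, and
`U`, `Uᴴ` have no entries between the sector and its complement, then the mixture `(w_a, Uψ_a)` also
satisfies `0 ≤ Σ_a w_a · Re ⟨Uψ_a, G_β(A; B, C) Uψ_a⟩` (covariance: this is the inequality for the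
sector-preserving observables `UᴴBU`, `UᴴCU` in the original mixture). [cite: DLS1978, §2 eq. (28)] -/
theorem sum_canonicalWeight_mul_re_expect_bog_mulVec_nonneg {A : Matrix ι ι ℂ} (hA : A.IsHermitian)
    (hinv : ∀ i j, ¬ p i → p j → A i j = 0) {U : Matrix ι ι ℂ} (hU : ∀ X : Matrix ι ι ℂ, Uᴴ * (U * X) = X)
    (hU' : ∀ X : Matrix ι ι ℂ, U * (Uᴴ * X) = X) (hUA : Commute U A)
    (hUp : ∀ i j, ¬ p i → p j → U i j = 0) (hUp' : ∀ i j, ¬ p i → p j → Uᴴ i j = 0)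
    {B C : Matrix ι ι ℂ} (hB : ∀ i j, ¬ p i → p j → B i j = 0) (hB' : ∀ i j, ¬ p i → p j → Bᴴ i j = 0)
    (hC : ∀ i j, ¬ p i → p j → C i j = 0) (hC' : ∀ i j, ¬ p i → p j → Cᴴ i j = 0)
    {β : ℝ} (hβ : 0 ≤ β) :
    0 ≤ ∑ a, canonicalWeight β (sectorEigenvalue p A hA) a *
      (star (U *ᵥ sectorEigenvector p A hA a) ⬝ᵥ
        ((B * Bᴴ + Bᴴ * B + ((2 : ℝ) : ℂ) • (C * B - B * C) +
            ((β / 2 : ℝ) : ℂ) • (Cᴴ * (A * C - C * A) - (A * C - C * A) * Cᴴ)) *ᵥ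
          (U *ᵥ sectorEigenvector p A hA a))).re := by
  have hadj : ∀ X : Matrix ι ι ℂ, (Uᴴ * X * U)ᴴ = Uᴴ * Xᴴ * U := fun X => by
    rw [conjTranspose_mul, conjTranspose_mul, conjTranspose_conjTranspose, Matrix.mul_assoc]
  have hB₁ : ∀ i j, ¬ p i → p j → (Uᴴ * B * U) i j = 0 :=
    mul_apply_eq_zero_off p (mul_apply_eq_zero_off p hUp' hB) hUp
  have hB₂ : ∀ i j, ¬ p i → p j → (Uᴴ * B * U)ᴴ i j = 0 := by
    rw [hadj]
    exact mul_apply_eq_zero_off p (mul_apply_eq_zero_off p hUp' hB') hUp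
  have hC₁ : ∀ i j, ¬ p i → p j → (Uᴴ * C * U) i j = 0 :=
    mul_apply_eq_zero_off p (mul_apply_eq_zero_off p hUp' hC) hUp
  have hC₂ : ∀ i j, ¬ p i → p j → (Uᴴ * C * U)ᴴ i j = 0 := by
    rw [hadj]
    exact mul_apply_eq_zero_off p (mul_apply_eq_zero_off p hUp' hC') hUp
  refine (sum_canonicalWeight_mul_re_expect_bog_nonneg p hA hinv hB₁ hB₂ hC₁ hC₂ hβ).trans_eq
    (Finset.sum_congr rfl fun a _ => ?_)
  rw [star_mulVec_dotProduct_bog_mulVec_mulVec hU hU' hUA]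

end Covariance

/-! ### §2 The canonical sector Gibbs state of the `t–t'` torus: the Bogoliubov row in the translated
eigen-mixtures `(p_{L,i}, U_v ψ_{L,i})` -/

section Torus

variable (L : ℕ)

/-- Canonical weights are invariant under reindexing the family of energies. [folklore] -/
private theorem canonicalWeight_comp_equiv_bog {κ κ' : Type*} [Fintype κ] [Fintype κ'] (e : κ' ≃ κ)
    (β : ℝ) (E : κ → ℝ) (a : κ') :
    canonicalWeight β (E ∘ e) a = canonicalWeight β E (e a) := by
  unfold canonicalWeight
  rw [show (∑ b, Real.exp (-(β * (E ∘ e) b))) = ∑ b, Real.exp (-(β * E b)) from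
    Equiv.sum_comp e (fun b => Real.exp (-(β * E b)))]
  rfl

variable [NeZero L]

/-- **The Bogoliubov row for the translated canonical Gibbs mixtures of the `t–t'` torus.** For
`H_L = hubbardTorusTT' L t t' U`, the canonical Gibbs data `(p_{L,i}, ψ_{L,i})` of the sector
`(rectN n L, S^z = 0)` at inverse temperature `β ≥ 0`, a translation `v`, and all torus operators
`B`, `C` commuting with `N` and `S^z`:
`0 ≤ Σ_i p_{L,i} Re⟨U_vψ_{L,i}, (BBᴴ + BᴴB + 2·(CB − BC) + (β/2)·(Cᴴ(H_L C − C H_L) − (H_L C − C H_L)Cᴴ)) U_vψ_{L,i}⟩`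
(`sum_canonicalWeight_mul_re_expect_bog_mulVec_nonneg`: `U_v` is unitary, commutes with `H_L` and
preserves the sector). No hypothesis on `t, t', U, n`. [cite: DLS1978, §2 eq. (28)] -/
theorem sum_sectorGibbsWeightTT'_mul_re_expect_bog_fockTranslate_nonneg (t t' U n : ℝ) {β : ℝ}
    (hβ : 0 ≤ β) (v : TorusSite 2 L)
    {B C : Matrix (Finset (Orb (FermionTorus 2 L))) (Finset (Orb (FermionTorus 2 L))) ℂ}
    (hBN : Commute B totalNumber) (hBS : Commute B HubbardWave0.spinZ)
    (hCN : Commute C totalNumber) (hCS : Commute C HubbardWave0.spinZ) :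
    0 ≤ ∑ i, sectorGibbsWeightTT' β t t' U n L i *
      (star ((fockTranslate v).val *ᵥ sectorGibbsVectorTT' t t' U n L i) ⬝ᵥ
        ((B * Bᴴ + Bᴴ * B + ((2 : ℝ) : ℂ) • (C * B - B * C) +
            ((β / 2 : ℝ) : ℂ) • (Cᴴ * (hubbardTorusTT' L t t' U * C - C * hubbardTorusTT' L t t' U) -
              (hubbardTorusTT' L t t' U * C - C * hubbardTorusTT' L t t' U) * Cᴴ)) *ᵥ
          ((fockTranslate v).val *ᵥ sectorGibbsVectorTT' t t' U n L i))).re := by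
  set H := hubbardTorusTT' L t t' U with hH
  have hA : H.IsHermitian := hubbardTorusTT'_isHermitian L t t' U
  have hinv : ∀ s s', ¬ szConfig n L s → szConfig n L s' → H s s' = 0 :=
    fun s s' hs hs' => hubbardTorusTT'_apply_eq_zero_of_szConfig L t t' U n s s' hs hs'
  have hUp' : ∀ s s', ¬ szConfig n L s → szConfig n L s' → (fockTranslate v).valᴴ s s' = 0 := by
    intro s s' hs hs'
    rw [fockTranslate_val_conjTranspose_eq_neg]
    exact fockTranslate_apply_eq_zero_of_szConfig L (-v) n s s' hs hs'
  have key := sum_canonicalWeight_mul_re_expect_bog_mulVec_nonneg (szConfig n L) hA hinv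
    (fockTranslate_val_conjTranspose_mul_val_mul L v) (fockTranslate_val_mul_val_conjTranspose_mul L v)
    (fockTranslate_commute_hubbardTorusTT' L v t t' U)
    (fun s s' hs hs' => fockTranslate_apply_eq_zero_of_szConfig L v n s s' hs hs') hUp'
    (apply_eq_zero_of_szConfig_of_commute L n hBN hBS)
    (conjTranspose_apply_eq_zero_of_szConfig_of_commute L n hBN hBS)
    (apply_eq_zero_of_szConfig_of_commute L n hCN hCS)
    (conjTranspose_apply_eq_zero_of_szConfig_of_commute L n hCN hCS) hβ
  -- transport the sum from `Subtype (szConfig n L)` to `Fin (sectorGibbsCount n L)`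
  set e := sectorGibbsIndex n L with he
  refine key.trans_eq ?_
  rw [← Equiv.sum_comp e]
  refine Finset.sum_congr rfl fun i _ => ?_
  rw [sectorGibbsWeightTT', show sectorGibbsEnergyTT' t t' U n L =
    sectorEigenvalue (szConfig n L) H hA ∘ e from rfl, canonicalWeight_comp_equiv_bog]
  rfl

end Torus

end Literature.MathematicalPhysics.QuantumLattice

end
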